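import Literature.NumberTheory.EllipticCurves.KubertTate133ShaFive
import Literature.NumberTheory.EllipticCurves.KubertTateFiveRationalTorsion
import Literature.NumberTheory.EllipticCurves.LocalReductionKrausMinimality
import Literature.NumberTheory.EllipticCurves.ComplexMultiplicationLocalFactorsAux
import Literature.NumberTheory.EllipticCurves.OrdinaryPrimesProofs
import Mathlib.Tactic.NormNum.Prime
import HarnessLib

/-!
# The twist `E_{13/3}^{(-4)} = [0, 56, 0, 9360, −219024]`: global minimality, reduction at `5` (`#W̃(𝔽₅) = 5`, `a₅ = 1`, good ordinary)

PROOF-ONLY file (theorems only, no definition, no named fact, no `sorry`), topic `NumberTheory/EllipticCurves`; the local data at the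
door prime `5` of the second Gaussian-twist row (tree `KubertTate133GaussianDescent`: `rank E_{13/3}^{(-4)}(ℚ) = 1`, `t₅ = 0`).
`E_{13/3} = [-10, -39, -117, 0, 0]` (`b₂ = -56`, `b₄ = 1170`, `b₆ = 13689`); its twist by `-4` in the tree's model is
`W = [0, 56, 0, 9360, -219024]`, `Δ_W = −2¹²·3⁵·13⁵·269`, `c₄ = −399104`, `c₆ = 328955392`; Kraus's test at `2` passes and `q¹² ∤ Δ` for odd
`q`, so `W` is globally minimal; `W mod 5 = [0,1,0,0,1]` has `4` affine points, `#W̃(𝔽₅) = 5`, `a₅(W) = 1`: **`5` is a good ordinary and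
ANOMALOUS (`a₅ ≡ 1 (mod 5)`) prime of `E_{13/3}^{(-4)}`** — the input of the placement of this rank-`1` door behind the anomalous
Eisenstein wall (Summits side).  Transfer statement T (stmt-22356) instrument; BSD is not proved by this.

## References

* [SilvermanAEC2009] J. H. Silverman, *AEC*, 2nd ed., VII.1 Remark 1.1, V.2, VIII.8, X.§2.
* [Kraus1989] A. Kraus, *Quelques remarques à propos des invariants c₄, c₆ et Δ d'une courbe elliptique*, Prop. 2.
-/

noncomputable section

open scoped Classical
open WeierstrassCurve Literature.NumberTheory.EllipticCurves
open Literature.NumberTheory.EllipticCurves.Rank1Residual.X11RankOneCertificates (discOf c4Of c6Of)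

namespace Literature.NumberTheory.EllipticCurves

namespace KubertTate133GaussianTwist

/-- **`E_{13/3}^{(-4)} = [0, 56, 0, 9360, −219024]`.** [cite: SilvermanAEC2009, X.§2] -/
theorem twist_eq : (kubertTateFive (((13 : ℤ) : ℚ)) (((3 : ℤ) : ℚ))).quadraticTwist (-4) =
    (⟨((0 : ℤ) : ℚ), ((56 : ℤ) : ℚ), ((0 : ℤ) : ℚ), ((9360 : ℤ) : ℚ), ((-219024 : ℤ) : ℚ)⟩ : WeierstrassCurve ℚ) := by
  rw [KubertTate133Descent.curve_eq]
  ext <;> simp [quadraticTwist, WeierstrassCurve.b₂, WeierstrassCurve.b₄, WeierstrassCurve.b₆] <;> norm_num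

/-- The twist is elliptic (`-4 ≠ 0`). [cite: SilvermanAEC2009, X.§2] -/
theorem isElliptic_twist :
    haveI := KubertTate133Descent.isElliptic
    ((kubertTateFive (((13 : ℤ) : ℚ)) (((3 : ℤ) : ℚ))).quadraticTwist (-4)).IsElliptic := by
  haveI := KubertTate133Descent.isElliptic
  exact isElliptic_quadraticTwist _ (by norm_num)

/-- `Δ`, `c₄`, `c₆` of the integer model (kernel evaluation). [folklore] -/
private theorem invariants_model :
    discOf [0, 56, 0, 9360, -219024] = -99411187838976 ∧ c4Of [0, 56, 0, 9360, -219024] = -399104 ∧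
    c6Of [0, 56, 0, 9360, -219024] = 328955392 := by
  refine ⟨?_, ?_, ?_⟩ <;> decide

/-- **The twist model is globally minimal** (Kraus at `2`: `2²⁴ ∤ Δ`, `2¹¹ ∤ c₆`, `2¹¹ ∤ c₆ − 2⁹`, `2⁸ ∤ c₆ + 2⁶`; `q¹² ∤ Δ = −2¹²·3⁵·13⁵·269`
for odd `q`). [cite: Kraus1989, Prop. 2] [cite: SilvermanAEC2009, VII.1 Remark 1.1 and VIII.8] -/
theorem isGloballyMinimal_model :
    (⟨((0 : ℤ) : ℚ), ((56 : ℤ) : ℚ), ((0 : ℤ) : ℚ), ((9360 : ℤ) : ℚ), ((-219024 : ℤ) : ℚ)⟩ : WeierstrassCurve ℚ).IsGloballyMinimal := by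
  obtain ⟨hD, hc4, hc6⟩ := invariants_model
  refine WeierstrassCurve.isGloballyMinimal_of_int_kraus 0 56 0 9360 (-219024) fun q hq ↦ ?_
  rcases eq_or_ne q 2 with rfl | h2
  · refine Or.inr (Or.inl ⟨rfl, ?_, ?_, ?_⟩)
    · rw [hD]; norm_num
    · rw [hc4, hc6]; norm_num
    · rw [hc6]; norm_num
  · refine Or.inl fun h ↦ ?_
    obtain ⟨h12, -⟩ := h
    rw [hD] at h12
    have hq1 : (q : ℤ) ∣ 99411187838976 := Int.dvd_neg.mp (dvd_trans (dvd_pow_self _ (by norm_num)) h12)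
    have hdvdN : q ∣ 2 ^ 12 * 3 ^ 5 * 13 ^ 5 * 269 := by
      have e : ((2 ^ 12 * 3 ^ 5 * 13 ^ 5 * 269 : ℕ) : ℤ) = 99411187838976 := by norm_num
      exact Int.natCast_dvd_natCast.mp (e ▸ hq1)
    have hpi := Nat.Prime.prime hq
    rcases hpi.dvd_or_dvd hdvdN with h | h
    · rcases hpi.dvd_or_dvd h with h | h
      · rcases hpi.dvd_or_dvd h with h | h
        · exact h2 ((Nat.prime_dvd_prime_iff_eq hq Nat.prime_two).mp (hpi.dvd_of_dvd_pow h))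
        · have := (Nat.prime_dvd_prime_iff_eq hq Nat.prime_three).mp (hpi.dvd_of_dvd_pow h)
          subst this; revert h12; norm_num
      · have := (Nat.prime_dvd_prime_iff_eq hq (by norm_num : Nat.Prime 13)).mp (hpi.dvd_of_dvd_pow h)
        subst this; revert h12; norm_num
    · have := (Nat.prime_dvd_prime_iff_eq hq (by norm_num : Nat.Prime 269)).mp h
      subst this; revert h12; norm_num

/-- The twist `E_{13/3}^{(-4)}` is globally minimal. [cite: Kraus1989, Prop. 2] [cite: SilvermanAEC2009, VIII.8] -/
theorem isGloballyMinimal_twist :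
    ((kubertTateFive (((13 : ℤ) : ℚ)) (((3 : ℤ) : ℚ))).quadraticTwist (-4)).IsGloballyMinimal := by
  rw [twist_eq]; exact isGloballyMinimal_model

/-- The tree's integral model of the twist is the integer equation. [cite: SilvermanAEC2009, VIII.8] -/
theorem integralModelInt_twist :
    haveI := isGloballyMinimal_twist
    integralModelInt ((kubertTateFive (((13 : ℤ) : ℚ)) (((3 : ℤ) : ℚ))).quadraticTwist (-4)) = ⟨0, 56, 0, 9360, -219024⟩ := by
  haveI := isGloballyMinimal_twist
  apply WeierstrassCurve.map_injective (f := Int.castRingHom ℚ) Int.cast_injective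
  beta_reduce
  rw [map_integralModelInt, twist_eq]
  ext <;> simp [WeierstrassCurve.map]

/-- The reduction of the integer model modulo `5`. [folklore] -/
private theorem map_zmod_five :
    (⟨0, 56, 0, 9360, -219024⟩ : WeierstrassCurve ℤ).map (Int.castRingHom (ZMod 5)) = (⟨0, 1, 0, 0, 1⟩ : WeierstrassCurve (ZMod 5)) := by
  ext <;> simp [WeierstrassCurve.map] <;> decide

/-- **`#W̃(𝔽₅) = 5`** (`y² = x³ + x² + 1` over `𝔽₅`: `4` affine points and `O`). [cite: SilvermanAEC2009, V.2] -/
theorem natCard_point_five :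
    Nat.card (((⟨0, 56, 0, 9360, -219024⟩ : WeierstrassCurve ℤ).map (Int.castRingHom (ZMod 5))).toAffine.Point) = 5 := by
  rw [map_zmod_five, natCard_point_eq_one_add_card (F := ZMod 5) _ (by decide)]
  have h : Fintype.card {xy : ZMod 5 × ZMod 5 //
      xy.2 ^ 2 + (⟨0, 1, 0, 0, 1⟩ : WeierstrassCurve (ZMod 5)).a₁ * xy.1 * xy.2 +
        (⟨0, 1, 0, 0, 1⟩ : WeierstrassCurve (ZMod 5)).a₃ * xy.2 =
      xy.1 ^ 3 + (⟨0, 1, 0, 0, 1⟩ : WeierstrassCurve (ZMod 5)).a₂ * xy.1 ^ 2 +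
        (⟨0, 1, 0, 0, 1⟩ : WeierstrassCurve (ZMod 5)).a₄ * xy.1 + (⟨0, 1, 0, 0, 1⟩ : WeierstrassCurve (ZMod 5)).a₆} = 4 := by
    decide +kernel
  rw [h]

/-- The integer discriminant of the twist model. [folklore] -/
private theorem Δ_model : (⟨0, 56, 0, 9360, -219024⟩ : WeierstrassCurve ℤ).Δ = -99411187838976 := by
  norm_num [WeierstrassCurve.Δ, WeierstrassCurve.b₂, WeierstrassCurve.b₄, WeierstrassCurve.b₆, WeierstrassCurve.b₈]

/-- **`a₅(E_{13/3}^{(-4)}) = 1`** and **`5` is a prime of good reduction of the twist** (`5 ∤ Δ_min`); since `5 ∤ a₅`, good ORDINARY, and since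
`a₅ ≡ 1 (mod 5)`, ANOMALOUS. [cite: SilvermanAEC2009, V.2 and VII.5 Prop. 5.1(a)] -/
theorem goodOrdinary_five_twist :
    haveI := isGloballyMinimal_twist
    haveI : Fact (Nat.Prime 5) := ⟨Nat.prime_five⟩
    ((kubertTateFive (((13 : ℤ) : ℚ)) (((3 : ℤ) : ℚ))).quadraticTwist (-4)).frobeniusTrace 5 = 1 ∧
      ((kubertTateFive (((13 : ℤ) : ℚ)) (((3 : ℤ) : ℚ))).quadraticTwist (-4)).HasGoodReductionAtPrime 5 := by
  haveI := isGloballyMinimal_twist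
  haveI : Fact (Nat.Prime 5) := ⟨Nat.prime_five⟩
  refine ⟨?_, hasGoodReductionAtPrime_of_not_dvd _ 5 ?_⟩
  · rw [WeierstrassCurve.frobeniusTrace, WeierstrassCurve.reductionPointCount, integralModelInt_twist, natCard_point_five]
    norm_num
  · rw [minimalDiscriminantInt, integralModelInt_twist, Δ_model]; norm_num

end KubertTate133GaussianTwist

end Literature.NumberTheory.EllipticCurves

end
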